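import Summits.KontsevichZagierPeriods.KontsevichZagierPeriods.Theorems.RealOnePeriodRelations.Negative.Kit
import Literature.NumberTheory.Transcendental.CurvePeriods
import Literature.NumberTheory.Transcendental.SemialgebraicMapsProofs
import Mathlib.LinearAlgebra.FiniteDimensional.Basic
import Mathlib.Analysis.Complex.RealDeriv

/-!
# `RealOnePeriodRelations` (stmt-KontsevichZagierPeriods-10042) — negative side: route vocabulary of line
# `nash-retraction-thin-strip` and the two semialgebraic arcs on `𝔾ₘ` (drefute, part 1 of 3)

Verbatim copies of the line's vocabulary (`IsSAPath`, `Realises`, `IsReplacement`, `IsCoherenceRadius`; the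
line's own vocabulary file `Theorems/SymplecticScissorsDefs.lean` is not in the tree yet), in this file's
namespace, and the typed objects of the coherence-locality witness (`Negative/CoherenceLocal`): the smooth
affine curve `𝔾ₘ = {xy = 1} ⊂ ℂ²` (`isSmoothAffineCurve_Gm`) and the two `ℚ`-semialgebraic `C^∞` arcs
`t ↦ ((2t−1) + i s (t²−t), ((2t−1) + i s (t²−t))⁻¹)`, `s = ±1`, from `(−1,−1)` to `(1,1)` passing below /
above the puncture (`arcPath`, `isSAPath_arcFun`). Used by `Negative/StubsLoadBearing` and
`Negative/CoherenceLocal`.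
-/

noncomputable section

open scoped BigOperators Topology ComplexConjugate
open Set MeasureTheory Filter
open Literature.NumberTheory.Transcendental Literature.NumberTheory.Transcendental.CurvePeriods
open Literature.ModelTheory.ExponentialFields (IsSemialgebraic isSemialgebraic_setOf_eval_nonneg
  isSemialgebraic_setOf_eval_le isSemialgebraic_setOf_eval_pos isSemialgebraic_setOf_eval_eq_zero)

namespace Summit.KontsevichZagierPeriods.SymplecticScissors.RealOnePeriodRelationsNegative.Stubs

/-! ## §0 Route vocabulary (verbatim copies of the line's definitions) -/

/-- A path `γ : ℝ → ℂⁿ` is a `ℚ`-SEMIALGEBRAIC PATH if its realification, as a map `ℝ¹ ⊇ [0,1] → ℝ²ⁿ`, is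
a `ℚ`-semialgebraic map on `[0,1]`. [cite: BochnakCosteRoy1998, Def. 2.2.5] -/
def IsSAPath {n : ℕ} (γ : ℝ → (Fin n → ℂ)) : Prop :=
  IsSemialgebraicMapOn ℚ {z : Fin 1 → ℝ | z 0 ∈ Set.Icc (0 : ℝ) 1}
    (fun z => Fin.append (fun i => (γ (z 0) i).re) (fun i => (γ (z 0) i).im))

/-- `r` REALISES `a · (ω, γ)`: `r = [∫₀¹ Re(a · Σᵢ ωᵢ(γ(t)) γᵢ′(t)) dt]`. [cite: HuberWustholz2022, Cor. 12.7] -/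
def Realises {n : ℕ} (r : KZ.IntegralRep 1) (a : ℂ) (ω : Fin n → MvPolynomial (Fin n) ℂ)
    (γ : ℝ → (Fin n → ℂ)) : Prop :=
  r.domain = {z | z 0 ∈ Set.Ioo (0 : ℝ) 1} ∧
    ∀ z ∈ r.domain, r.integrand z =
      (a * ∑ i, MvPolynomial.eval (γ (z 0)) (ω i) * deriv (fun u => γ u i) (z 0)).re

/-- `γ'` is an `ε`-REPLACEMENT of `γ`: semialgebraic, same end points, `C⁰`-`ε`-close on `[0,1]`. [folklore] -/
def IsReplacement {Z : CurveData} (γ : CurvePath Z) (ε : ℝ) (γ' : CurvePath Z) : Prop :=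
  IsSAPath γ'.toFun ∧ γ'.toFun 0 = γ.toFun 0 ∧ γ'.toFun 1 = γ.toFun 1 ∧
    ∀ t ∈ Set.Icc (0 : ℝ) 1, dist (γ'.toFun t) (γ.toFun t) ≤ ε

/-- `ε` is a COHERENCE RADIUS for `(Z, γ)`: `ε > 0` and any two real realisations of `a · (ω, ·)` along two
`ε`-replacements of `γ` agree modulo `M₁`. [cite: KontsevichZagier2001, §1.2] -/
def IsCoherenceRadius (Z : CurveData) (γ : CurvePath Z) (ε : ℝ) : Prop :=
  0 < ε ∧ ∀ (ω : Fin Z.n → MvPolynomial (Fin Z.n) ℂ), (∀ i, HasAlgCoeffs (ω i)) →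
    ∀ (a : ℂ), IsAlgebraic ℚ a → ∀ (γa γb : CurvePath Z), IsReplacement γ ε γa → IsReplacement γ ε γb →
      ∀ (ra rb : KZ.IntegralRep 1), Realises ra a ω γa.toFun → Realises rb a ω γb.toFun →
        KZ.of ra - KZ.of rb ∈ M₁

/-! ## §0′ The parameter interval -/

/-- The parameter interval `[0,1] ⊂ ℝ¹`. [folklore] -/
def I01 : Set (Fin 1 → ℝ) := {z : Fin 1 → ℝ | z 0 ∈ Set.Icc (0 : ℝ) 1}

/-- `I01` is `ℚ`-semialgebraic. [folklore] -/
theorem isSemialgebraic_I01 : IsSemialgebraic ℚ I01 := by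
  have h0 := isSemialgebraic_setOf_eval_nonneg (k := ℚ) (R := ℝ)
    (MvPolynomial.X (0 : Fin 1) : MvPolynomial (Fin 1) ℚ)
  have h1 := isSemialgebraic_setOf_eval_le (k := ℚ) (R := ℝ)
    (MvPolynomial.X (0 : Fin 1) : MvPolynomial (Fin 1) ℚ) 1
  have hI : I01 = {x : Fin 1 → ℝ | 0 ≤ MvPolynomial.aeval x (MvPolynomial.X (0 : Fin 1) : MvPolynomial (Fin 1) ℚ)} ∩
      {x : Fin 1 → ℝ | MvPolynomial.aeval x (MvPolynomial.X (0 : Fin 1) : MvPolynomial (Fin 1) ℚ) ≤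
        MvPolynomial.aeval x (1 : MvPolynomial (Fin 1) ℚ)} := by
    ext p
    simp [I01]
  rw [hI]
  exact h0.inter h1

/-! ## §1 The smooth affine curve `𝔾ₘ = {x y = 1}` -/

/-- `𝔾ₘ` embedded as the hyperbola `x₀ x₁ = 1` in `ℂ²`. [folklore] -/
abbrev Gm : CurveData := ⟨2, 1, fun _ => MvPolynomial.X 0 * MvPolynomial.X 1 - 1⟩

/-- Points of `𝔾ₘ`. [folklore] -/
theorem mem_points_Gm {z : Fin 2 → ℂ} : z ∈ Gm.points ↔ z 0 * z 1 = 1 := by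
  simp [CurveData.points, sub_eq_zero, MvPolynomial.eval_X]

/-- The gradient of the equation of `𝔾ₘ` at `z` is `(z₁, z₀)`. [folklore] -/
theorem gradient_Gm (j : Fin Gm.m) (z : Fin 2 → ℂ) : Gm.gradient j z = ![z 1, z 0] := by
  ext i
  fin_cases i
  · simp [CurveData.gradient, Derivation.leibniz, MvPolynomial.pderiv_X]
  · simp [CurveData.gradient, Derivation.leibniz, MvPolynomial.pderiv_X]

/-- The equation of `𝔾ₘ` has rational (hence algebraic) coefficients. [folklore] -/
theorem hasAlgCoeffs_Gm (j : Fin Gm.m) : HasAlgCoeffs (Gm.F j) := by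
  intro d
  have h : (Gm.F j) = MvPolynomial.map (algebraMap ℚ ℂ) (MvPolynomial.X 0 * MvPolynomial.X 1 - 1) := by
    simp [MvPolynomial.map_X]
  rw [h, MvPolynomial.coeff_map]
  exact isAlgebraic_algebraMap _

/-- `𝔾ₘ` is a smooth affine curve over `ℚ̄` in the sense of `CurveData.IsSmoothAffineCurve`. [folklore] -/
theorem isSmoothAffineCurve_Gm : Gm.IsSmoothAffineCurve where
  algebraic := hasAlgCoeffs_Gm
  rank_eq := by
    intro z hz
    rw [mem_points_Gm] at hz
    have hz0 : z 0 ≠ 0 := by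
      intro h0
      rw [h0, zero_mul] at hz
      exact zero_ne_one hz
    have hv : (![z 1, z 0] : Fin 2 → ℂ) ≠ 0 := by
      intro h
      have := congrFun h 1
      simp at this
      exact hz0 this
    have hrange : (Set.range fun j : Fin Gm.m => Gm.gradient j z) = {![z 1, z 0]} := by
      ext v
      simp only [Set.mem_range, Set.mem_singleton_iff, gradient_Gm]
      constructor
      · rintro ⟨_, rfl⟩; rfl
      · rintro rfl; exact ⟨0, rfl⟩
    rw [hrange, finrank_span_singleton hv]
    rfl
  not_isolated := by
    intro z hz
    rw [mem_points_Gm] at hz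
    have hz0 : z 0 ≠ 0 := by
      intro h0
      rw [h0, zero_mul] at hz
      exact zero_ne_one hz
    -- the sequence `w n = (z₀ (1 + cₙ), z₁ (1 + cₙ)⁻¹)`, `cₙ = 1/(n+1)`
    set c : ℕ → ℂ := fun n => ((1 / ((n : ℝ) + 1) : ℝ) : ℂ) with hc
    have hc0 : Tendsto c atTop (𝓝 0) := by
      have h : Tendsto (fun n : ℕ => 1 / ((n : ℝ) + 1)) atTop (𝓝 0) :=
        tendsto_one_div_add_atTop_nhds_zero_nat
      rw [hc]
      exact (Complex.continuous_ofReal.tendsto' 0 0 (by simp)).comp h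
    have hcpos : ∀ n, c n ≠ 0 := by
      intro n
      simp only [hc, one_div, ne_eq, Complex.ofReal_eq_zero, inv_eq_zero]
      positivity
    have hc1 : ∀ n, 1 + c n ≠ 0 := by
      intro n
      have : (1 + c n) = (((1 + 1 / ((n : ℝ) + 1)) : ℝ) : ℂ) := by simp [hc]
      rw [this, ne_eq, Complex.ofReal_eq_zero]
      positivity
    set w : ℕ → (Fin 2 → ℂ) := fun n => ![z 0 * (1 + c n), z 1 * (1 + c n)⁻¹] with hw
    have hwmem : ∀ n, w n ∈ Gm.points \ {z} := by
      intro n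
      refine ⟨?_, ?_⟩
      · rw [mem_points_Gm]
        simp only [hw, Matrix.cons_val_zero, Matrix.cons_val_one]
        calc z 0 * (1 + c n) * (z 1 * (1 + c n)⁻¹)
            = (z 0 * z 1) * ((1 + c n) * (1 + c n)⁻¹) := by ring
          _ = 1 := by rw [hz, mul_inv_cancel₀ (hc1 n), mul_one]
      · intro h
        have h0 := congrFun h 0
        simp only [hw, Matrix.cons_val_zero] at h0
        have : z 0 * c n = 0 := by linear_combination h0
        rcases mul_eq_zero.mp this with h | h
        · exact hz0 h
        · exact hcpos n h
    have hwt : Tendsto w atTop (𝓝 z) := by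
      rw [tendsto_pi_nhds]
      intro i
      fin_cases i
      · have : Tendsto (fun n => z 0 * (1 + c n)) atTop (𝓝 (z 0 * (1 + 0))) :=
          tendsto_const_nhds.mul (tendsto_const_nhds.add hc0)
        simpa [hw] using this
      · have : Tendsto (fun n => z 1 * (1 + c n)⁻¹) atTop (𝓝 (z 1 * (1 + 0)⁻¹)) :=
          tendsto_const_nhds.mul ((tendsto_const_nhds.add hc0).inv₀ (by norm_num))
        simpa [hw] using this
    exact mem_closure_of_tendsto hwt (Eventually.of_forall hwmem)

/-! ## §2 The two arcs `x = (2t − 1) + i s (t² − t)`, `s = ±1` -/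

/-- `D s t = (2t − 1) + i·s·(t² − t)`: for `s ≠ 0` a complex polynomial path in `ℂ ∖ {0}` from `−1`
to `1` (below the origin for `s > 0`, above for `s < 0`). [folklore] -/
def D (s : ℚ) (t : ℝ) : ℂ := ((2 * t - 1 : ℝ) : ℂ) + (((s : ℝ) * (t ^ 2 - t) : ℝ) : ℂ) * Complex.I

/-- Real part of `D`. [folklore] -/
@[simp] theorem D_re (s : ℚ) (t : ℝ) : (D s t).re = 2 * t - 1 := by
  simp only [D, Complex.add_re, Complex.ofReal_re, Complex.mul_re, Complex.I_re, Complex.I_im,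
    Complex.ofReal_im]
  ring

/-- Imaginary part of `D`. [folklore] -/
@[simp] theorem D_im (s : ℚ) (t : ℝ) : (D s t).im = (s : ℝ) * (t ^ 2 - t) := by
  simp only [D, Complex.add_im, Complex.ofReal_im, Complex.mul_im, Complex.I_re, Complex.I_im,
    Complex.ofReal_re]
  ring

/-- `|D s t|² = (2t−1)² + s²(t²−t)²`. [folklore] -/
theorem normSq_D (s : ℚ) (t : ℝ) :
    Complex.normSq (D s t) = (2 * t - 1) ^ 2 + (s : ℝ) ^ 2 * (t ^ 2 - t) ^ 2 := by
  rw [Complex.normSq_apply, D_re, D_im]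
  ring

/-- For `s ≠ 0`, `|D s t|² > 0` (at `t = 1/2` the imaginary part is `−s/4`). [folklore] -/
theorem normSq_D_pos {s : ℚ} (hs : s ≠ 0) (t : ℝ) : 0 < Complex.normSq (D s t) := by
  rw [normSq_D]
  have hs' : (0 : ℝ) < (s : ℝ) ^ 2 := by positivity
  by_contra h
  push Not at h
  have h1 : (2 * t - 1) ^ 2 = 0 := by nlinarith [sq_nonneg (2 * t - 1), mul_nonneg hs'.le (sq_nonneg (t ^ 2 - t))]
  have h2 : (s : ℝ) ^ 2 * (t ^ 2 - t) ^ 2 = 0 := by nlinarith [sq_nonneg (2 * t - 1), mul_nonneg hs'.le (sq_nonneg (t ^ 2 - t))]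
  have ht : t = 1 / 2 := by nlinarith [sq_eq_zero_iff.mp h1]
  rw [ht] at h2
  norm_num at h2
  exact hs (by exact_mod_cast h2)

/-- `D s t ≠ 0` for `s ≠ 0`. [folklore] -/
theorem D_ne_zero {s : ℚ} (hs : s ≠ 0) (t : ℝ) : D s t ≠ 0 := by
  intro h
  have := normSq_D_pos hs t
  rw [h, map_zero] at this
  exact lt_irrefl _ this

/-- For `s = ±1`: `|D s t|² ≥ 1/16` everywhere. [folklore] -/
theorem normSq_D_ge {s : ℚ} (hs : s ^ 2 = 1) (t : ℝ) : 1 / 16 ≤ Complex.normSq (D s t) := by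
  rw [normSq_D]
  have hs' : (s : ℝ) ^ 2 = 1 := by exact_mod_cast hs
  rw [hs', one_mul]
  nlinarith [sq_nonneg (t - 1 / 2), sq_nonneg ((t - 1 / 2) ^ 2)]

/-- `dD/dt = 2 + i s (2t − 1)`. [folklore] -/
theorem hasDerivAt_D (s : ℚ) (t : ℝ) :
    HasDerivAt (D s) (((2 : ℝ) : ℂ) + (((s : ℝ) * (2 * t - 1) : ℝ) : ℂ) * Complex.I) t := by
  have h1 : HasDerivAt (fun t : ℝ => 2 * t - 1) 2 t := by
    simpa using ((hasDerivAt_id t).const_mul (2 : ℝ)).sub_const 1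
  have h2 : HasDerivAt (fun t : ℝ => (s : ℝ) * (t ^ 2 - t)) ((s : ℝ) * (2 * t - 1)) t := by
    have := ((hasDerivAt_pow 2 t).sub (hasDerivAt_id t)).const_mul (s : ℝ)
    simpa using this
  have h := h1.ofReal_comp.add (h2.ofReal_comp.mul_const Complex.I)
  exact h

/-- The arc `t ↦ (D s t, (D s t)⁻¹)` on `𝔾ₘ` (`s ≠ 0`), from `(−1,−1)` to `(1,1)`. [folklore] -/
def arcFun (s : ℚ) (t : ℝ) : Fin 2 → ℂ := ![D s t, (D s t)⁻¹]

/-- First coordinate of the arc. [folklore] -/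
@[simp] theorem arcFun_zero (s : ℚ) (t : ℝ) : arcFun s t 0 = D s t := rfl

/-- Second coordinate of the arc. [folklore] -/
@[simp] theorem arcFun_one (s : ℚ) (t : ℝ) : arcFun s t 1 = (D s t)⁻¹ := rfl

/-- `D s 0 = −1`. [folklore] -/
theorem D_at_zero (s : ℚ) : D s 0 = -1 := by
  norm_num [D]

/-- `D s 1 = 1`. [folklore] -/
theorem D_at_one (s : ℚ) : D s 1 = 1 := by
  norm_num [D]

/-- The arcs as `CurvePath`s on `𝔾ₘ`: `C^∞` on `[0,1]`, on the curve, algebraic (integer) end points. [folklore] -/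
def arcPath (s : ℚ) (hs : s ≠ 0) : CurvePath Gm where
  toFun := arcFun s
  contDiffOn := by
    apply ContDiff.contDiffOn
    rw [contDiff_pi]
    have hof : ContDiff ℝ 1 (fun x : ℝ => (x : ℂ)) := Complex.ofRealCLM.contDiff
    have hD : ContDiff ℝ 1 (D s) := by
      unfold D
      exact (hof.comp (by fun_prop)).add ((hof.comp (by fun_prop)).mul contDiff_const)
    intro i
    fin_cases i
    · exact hD
    · exact hD.inv fun t => D_ne_zero hs t
  mem_points := by
    intro t _
    rw [mem_points_Gm]
    simp [mul_inv_cancel₀ (D_ne_zero hs t)]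
  algebraic_zero := by
    intro i
    fin_cases i
    · simp [D_at_zero]
      exact isAlgebraic_one.neg
    · simp [D_at_zero]
      exact isAlgebraic_one.neg
  algebraic_one := by
    intro i
    fin_cases i
    · simpa [D_at_one] using isAlgebraic_one
    · simpa [D_at_one] using isAlgebraic_one


/-! ## §3 The arcs are `ℚ`-semialgebraic paths -/

/-- `Fin.append` of two pairs, as a 4-vector. [folklore] -/
theorem append_two_two (f g : Fin 2 → ℝ) : Fin.append f g = ![f 0, f 1, g 0, g 1] := by
  ext i
  fin_cases i <;> rfl

/-- The denominator polynomial `(2X−1)² + s²(X²−X)²` over `ℚ`. [folklore] -/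
def qPoly (s : ℚ) : MvPolynomial (Fin 1) ℚ :=
  (2 * MvPolynomial.X 0 - 1) ^ 2 + MvPolynomial.C (s ^ 2) * (MvPolynomial.X 0 ^ 2 - MvPolynomial.X 0) ^ 2

/-- `qPoly` evaluates to `|D|²`. [folklore] -/
theorem aeval_qPoly (s : ℚ) (x : Fin 1 → ℝ) :
    MvPolynomial.aeval x (qPoly s) = Complex.normSq (D s (x 0)) := by
  rw [normSq_D]
  simp [qPoly]

/-- `qPoly` does not vanish (for `s ≠ 0`). [folklore] -/
theorem aeval_qPoly_ne_zero {s : ℚ} (hs : s ≠ 0) (x : Fin 1 → ℝ) :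
    MvPolynomial.aeval x (qPoly s) ≠ 0 := by
  rw [aeval_qPoly]
  exact (normSq_D_pos hs (x 0)).ne'

/-- The four real coordinates `Re x, Re y, Im x, Im y` of the arc are `ℚ`-semialgebraic (polynomial,
resp. rational with the non-vanishing denominator `|D|²`) functions of `t ∈ [0,1]`. [folklore] -/
theorem isSAPath_arcFun {s : ℚ} (hs : s ≠ 0) : IsSAPath (arcFun s) := by
  unfold IsSAPath
  have hI : IsSemialgebraic ℚ {z : Fin 1 → ℝ | z 0 ∈ Set.Icc (0 : ℝ) 1} := isSemialgebraic_I01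
  refine IsSemialgebraicMapOn.of_forall hI fun j => ?_
  simp only [append_two_two]
  fin_cases j
  · -- `Re x = 2t − 1`
    refine (isSemialgebraicFunOn_aeval hI (2 * MvPolynomial.X 0 - 1 : MvPolynomial (Fin 1) ℚ)).congr ?_
    intro x _
    simp
  · -- `Re y = (2t − 1)/|D|²`
    refine (isSemialgebraicFunOn_aeval_div_aeval hI (2 * MvPolynomial.X 0 - 1 : MvPolynomial (Fin 1) ℚ)
      (qPoly s) fun x _ => aeval_qPoly_ne_zero hs x).congr ?_
    intro x _
    simp [aeval_qPoly, Complex.inv_re]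
  · -- `Im x = s (t² − t)`
    refine (isSemialgebraicFunOn_aeval hI
      (MvPolynomial.C s * (MvPolynomial.X 0 ^ 2 - MvPolynomial.X 0) : MvPolynomial (Fin 1) ℚ)).congr ?_
    intro x _
    simp
  · -- `Im y = −s (t² − t)/|D|²`
    refine (isSemialgebraicFunOn_aeval_div_aeval hI
      (-(MvPolynomial.C s * (MvPolynomial.X 0 ^ 2 - MvPolynomial.X 0)) : MvPolynomial (Fin 1) ℚ)
      (qPoly s) fun x _ => aeval_qPoly_ne_zero hs x).congr ?_
    intro x _
    simp [aeval_qPoly, Complex.inv_im, neg_div]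

end Summit.KontsevichZagierPeriods.SymplecticScissors.RealOnePeriodRelationsNegative.Stubs

end
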